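import Literature.AlgebraicGeometry.Frobenioids.BCatOrbits
import Literature.IUT.HodgeTheaters.GlobalFrobenioidsBaseIdentify
import Literature.IUT.HodgeTheaters.GlobalFrobenioidsArithmeticClosers
import HarnessLib

/-!
# [IUTchI] Example 5.1 (iii), p. 125: the law binder `BaseCatRigid` of the layer-5 certificate conjunct E51/L11 is
# SATISFIABLE — non-vacuity witness at the trivial group (proof-only)

S. Mochizuki, *Inter-universal Teichmüller theory I*, kurims manuscript (May 2020), §5, Example 5.1 (iii), p. 125
l. 50–57 ([IUTchI] Ex 5.1 (iii) p.125) [claim: Mochizuki2012, status: disputed]: the isomorphism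
`Base(†ℱ^⊛) ⥲ †𝒟^⊛` is "uniquely determined, in light of the `F`-coricity of `C_F`, together with [AbsTopIII],
Theorem 1.9".  abc-iut-w5-d110 (gen 1, `GlobalFrobenioidsBaseIdentify.lean`) typed the bracket as the INTERMEDIATE
STATEMENT `BaseCatRigid G` («every self-equivalence of `†𝒟^⊛ = ℬ(G)⁰` is isomorphic to the identity», for
`G = π₁(†𝒟^⊛)`) and PROVED the printed uniqueness from it (`GlobalFrobenioid.identify_unique`); the layer-5
certificate conjunct `Summit.ABC.IUTFork.Conditional.layer5_held_ex51i_L11` (`Conditional/Layer5OfSEx51.lean`, cert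
v0.1) binds `h_Ex51i_BaseCatRigid : BaseCatRigid G` as a LAW.  Sub-DAG `plan/L5/SUBDAG-IUTchI-Ex51.md` row E51/L11;
node `IUTchI:Ex5.1(i)`.

PROOF-ONLY (no `def`, no `instance`, no new `Prop` fact).  Until this file the predicate `BaseCatRigid` had NO producer
in the tree, so the conjunct E51/L11 was unwitnessed (its binder might have been unsatisfiable at EVERY profinite
group).  This file supplies the NON-VACUITY WITNESS required by the layer's «one witness per consumer binder set» rule:

* `BCat.eq_of_isConnectedObj_of_subsingleton` — over a TRIVIAL group every connected object of `ℬ(G)` (one `G`-orbit,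
  abc-iut-L1's `BCat.exists_smul_eq_of_isConnectedObj`) has exactly one point; hence (`BCat.nonempty_hom_…`,
  `BCat.hom_eq_…`) between connected objects there is EXACTLY ONE morphism;
* `baseCatRigid_of_subsingleton` — consequently every self-equivalence (indeed every endofunctor) of `ℬ(G)⁰` is
  isomorphic to the identity: `BaseCatRigid G` HOLDS for `G` trivial; `baseCatRigid_punit`, `exists_baseCatRigid`;
* `exists_ex51i_L11_binders_fires` — the JOINT witness of the binder SET of `layer5_held_ex51i_L11`: a profinite
  group `G`, divisor data `Δ : GlobalDivisorData G`, a global Frobenioid `†ℱ^⊛` over `†𝒟^⊚ → †𝒟^⊛ := 𝟭` (abc-iut-L5's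
  `nonempty_globalFrobenioid`) AND `BaseCatRigid G`, at which the conclusion of `GlobalFrobenioid.identify_unique`
  FIRES.

HONEST LABEL: «[degenerate: trivial group; `ℬ(1)⁰` is equivalent to the one-point category]».  A witness is
consistency evidence for OUR binder only — it says nothing about the genuine `π₁(†𝒟^⊛)` of a `𝒟`-ΘNF-Hodge theater
(there the predicate is the content of the `F`-coricity of `C_F` + [AbsTopIII] Thm 1.9, an after-merge input) and
`BaseCatRigid G` is certainly NOT claimed for general `G`; inhabited ≠ discharged; no side is taken on [IUTchIII]
Cor. 3.12; nothing of the disputed series is asserted; typed ≠ proved.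
-/

namespace Literature.AlgebraicGeometry.Frobenioids

namespace BCat

open CategoryTheory

universe u

variable {G : Type u} [Group G] [TopologicalSpace G] [IsTopologicalGroup G] [Subsingleton G]

/-- Over a trivial group, a connected object of `ℬ(G)` (one `G`-orbit, [FrdI] §0 p. 15) has at most one point.
[cite: MochizukiFrdI2008, §0 p.15] -/
theorem eq_of_isConnectedObj_of_subsingleton (X : BCat G) (hX : IsConnectedObj X) (x y : X.obj.V) : x = y := by
  obtain ⟨g, hg⟩ := exists_smul_eq_of_isConnectedObj X hX x y
  rw [Subsingleton.elim g 1, one_smul] at hg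
  exact hg

/-- Over a trivial group, any two morphisms of `ℬ(G)` into a connected object coincide.
[cite: MochizukiFrdI2008, §0 p.15] -/
theorem hom_eq_of_isConnectedObj_of_subsingleton {X Y : BCat G} (hY : IsConnectedObj Y) (f f' : X ⟶ Y) :
    f = f' :=
  hom_ext_apply fun _ => eq_of_isConnectedObj_of_subsingleton Y hY _ _

/-- Over a trivial group, every object of `ℬ(G)` maps to every connected object (the constant map to its point is
equivariant). [cite: MochizukiFrdI2008, §0 p.15] -/
theorem nonempty_hom_of_isConnectedObj_of_subsingleton (X Y : BCat G) (hY : IsConnectedObj Y) :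
    Nonempty (X ⟶ Y) := by
  obtain ⟨y₀⟩ := nonempty_of_isNonemptyObj Y hY.1
  exact ⟨ObjectProperty.homMk
    { hom := FintypeCat.homMk fun _ => y₀
      comm := fun _ => FintypeCat.hom_ext _ _ fun _ => eq_of_isConnectedObj_of_subsingleton Y hY _ _ }⟩

end BCat

end Literature.AlgebraicGeometry.Frobenioids

namespace Literature.IUT.HodgeTheaters

open CategoryTheory Literature.AlgebraicGeometry.Frobenioids

universe u

/-! ### `BaseCatRigid` holds over a trivial group -/

/-- In `†𝒟^⊛ = ℬ(G)⁰` with `G` trivial there is exactly one morphism between any two objects: existence.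
([IUTchI] Ex 5.1 (iii) p.125) [claim: Mochizuki2012, status: disputed] -/
theorem BaseCat.nonempty_hom_of_subsingleton {G : ProfiniteGrp.{u}} [Subsingleton G] (X Y : BaseCat G) :
    Nonempty (X ⟶ Y) := by
  obtain ⟨f⟩ := BCat.nonempty_hom_of_isConnectedObj_of_subsingleton X.obj Y.obj Y.property
  exact ⟨ObjectProperty.homMk f⟩

/-- In `†𝒟^⊛ = ℬ(G)⁰` with `G` trivial there is exactly one morphism between any two objects: uniqueness.
([IUTchI] Ex 5.1 (iii) p.125) [claim: Mochizuki2012, status: disputed] -/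
theorem BaseCat.hom_eq_of_subsingleton {G : ProfiniteGrp.{u}} [Subsingleton G] {X Y : BaseCat G} (f f' : X ⟶ Y) :
    f = f' :=
  ObjectProperty.hom_ext _ (BCat.hom_eq_of_isConnectedObj_of_subsingleton Y.property f.hom f'.hom)

/-- Every endofunctor of `ℬ(G)⁰`, `G` trivial, is isomorphic to the identity functor (all objects are uniquely
isomorphic to each other). ([IUTchI] Ex 5.1 (iii) p.125) [claim: Mochizuki2012, status: disputed] -/
theorem BaseCat.nonempty_iso_id_of_subsingleton {G : ProfiniteGrp.{u}} [Subsingleton G] (Φ : BaseCat G ⥤ BaseCat G) :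
    Nonempty (Φ ≅ 𝟭 (BaseCat G)) :=
  ⟨NatIso.ofComponents
    (fun X =>
      { hom := (BaseCat.nonempty_hom_of_subsingleton (Φ.obj X) X).some
        inv := (BaseCat.nonempty_hom_of_subsingleton X (Φ.obj X)).some
        hom_inv_id := BaseCat.hom_eq_of_subsingleton _ _
        inv_hom_id := BaseCat.hom_eq_of_subsingleton _ _ })
    fun _ => BaseCat.hom_eq_of_subsingleton _ _⟩

/-- **`BaseCatRigid G` HOLDS for a trivial profinite group `G`**: every self-equivalence of `ℬ(G)⁰` is isomorphic to
the identity. [degenerate witness] ([IUTchI] Ex 5.1 (iii) p.125) [claim: Mochizuki2012, status: disputed] -/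
theorem baseCatRigid_of_subsingleton (G : ProfiniteGrp.{u}) [Subsingleton G] : BaseCatRigid G :=
  ⟨fun Φ => BaseCat.nonempty_iso_id_of_subsingleton Φ.functor⟩

/-- **`BaseCatRigid` at the one-element profinite group.** [degenerate witness] ([IUTchI] Ex 5.1 (iii) p.125)
[claim: Mochizuki2012, status: disputed] -/
theorem baseCatRigid_punit : BaseCatRigid (ProfiniteGrp.of PUnit.{u + 1}) :=
  haveI : Subsingleton (ProfiniteGrp.of PUnit.{u + 1}) := ⟨fun _ _ => rfl⟩
  baseCatRigid_of_subsingleton _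

/-- **NON-VACUITY of the law binder of the certificate conjunct E51/L11**: `BaseCatRigid` has an instance.
[degenerate: trivial group] ([IUTchI] Ex 5.1 (iii) p.125) [claim: Mochizuki2012, status: disputed] -/
theorem exists_baseCatRigid : ∃ G : ProfiniteGrp.{u}, BaseCatRigid G :=
  ⟨ProfiniteGrp.of PUnit.{u + 1}, baseCatRigid_punit⟩

/-! ### The binder set of `layer5_held_ex51i_L11` is jointly inhabited and its conclusion fires -/

/-- **JOINT NON-VACUITY WITNESS for `Summit.ABC.IUTFork.Conditional.layer5_held_ex51i_L11`** (cert L5 v0.1, row 1112,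
sub-row E51/L11): there are a profinite group `G`, divisor data `Δ` on `†𝒟^⊛ = ℬ(G)⁰`, a global Frobenioid `†ℱ^⊛`
over the natural morphism `†𝒟^⊚ → †𝒟^⊛` (here `𝟭`), such that the LAW `BaseCatRigid G` holds — and then the printed
uniqueness «the isomorphism `Base(†ℱ^⊛) ⥲ †𝒟^⊛` is uniquely determined» FIRES (abc-iut-w5-d110
`GlobalFrobenioid.identify_unique`).  `G := 1`, `Δ :=` the constant trivial divisor monoid with `div := 𝟙`,
`†ℱ^⊛ :=` abc-iut-L5's model witness `nonempty_globalFrobenioid`.  [degenerate: trivial group] — inhabited ≠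
discharged; nothing is claimed about the genuine `π₁(†𝒟^⊛)`. ([IUTchI] Ex 5.1 (iii) p.125)
[claim: Mochizuki2012, status: disputed] -/
theorem exists_ex51i_L11_binders_fires :
    ∃ (G : ProfiniteGrp.{0}) (Δ : GlobalDivisorData G) (F : GlobalFrobenioid Δ (BaseCat G) (𝟭 (BaseCat G))),
      BaseCatRigid G ∧ ∀ I' : F.Base ≌ BaseCat G, Nonempty (I'.functor ≅ F.identify.functor) := by
  let G0 : ProfiniteGrp.{0} := ProfiniteGrp.of PUnit.{1}
  let Φ0 : (BaseCat G0)ᵒᵖ ⥤ CommMonCat.{0} := (Functor.const _).obj (CommMonCat.of PUnit.{1})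
  let Δ0 : GlobalDivisorData G0 := { Φ := Φ0, B := monoidGp Φ0, div := 𝟙 _ }
  obtain ⟨F⟩ := nonempty_globalFrobenioid Δ0 (BaseCat G0) (𝟭 (BaseCat G0))
  exact ⟨G0, Δ0, F, baseCatRigid_punit, fun I' => GlobalFrobenioid.identify_unique F baseCatRigid_punit I'⟩

end Literature.IUT.HodgeTheaters
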